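import Mathlib
import Summits.MatrixMultiplication.MatrixMultiplication.Theses.SnSubsetDichotomy

/-!
# Sketch — crux-ideate stmt-MatrixMultiplication-10882 (ThresholdSubsetTriples), ideator 2, round 1

First lemmas for the two idea cards:
* `cyclotomic-triality`: `tpp_triality_iff` (the Z₃-symmetric TPP is a single-set twisted-corner condition),
  the transfer `TrialityThreshold` and `thresholdSubsetTriples_of_triality`.
* `pairing-principle-reduction`: the structure conjecture `PairingStructure` (negative-side companion) and the
  right-translation invariance `tpp_mul_right` used to move structured parts into matching centralisers.
-/

namespace Summit.MatrixMultiplication.MatrixMultiplication.Cruxes.ThresholdSubsetTriples.Ideator2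

open Literature.Combinatorics.Additive
open Summit.MatrixMultiplication.MatrixMultiplication.Theses

variable {G : Type*} [Group G] [DecidableEq G]

/-- Conjugate of a finite set by `τ`: `τ X τ⁻¹`. -/
def conjSet (τ : G) (X : Finset G) : Finset G := X.image (fun x => τ * x * τ⁻¹)

omit [DecidableEq G] in
theorem conj_injective (τ : G) : Function.Injective (fun x : G => τ * x * τ⁻¹) := by
  intro a b h
  simpa using h

theorem card_conjSet (τ : G) (X : Finset G) : (conjSet τ X).card = X.card :=
  Finset.card_image_of_injective _ (conj_injective τ)

theorem mem_conjSet {τ : G} {X : Finset G} {y : G} : y ∈ conjSet τ X ↔ ∃ x ∈ X, τ * x * τ⁻¹ = y := by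
  simp [conjSet]

/-- TPP is invariant under independent right translation of the three sets (quotient sets are unchanged). -/
theorem tpp_mul_right (S T U : Finset G) (a b c : G) (h : TripleProductProperty S T U) :
    TripleProductProperty (S.image (· * a)) (T.image (· * b)) (U.image (· * c)) := by
  intro s hs s' hs' t ht t' ht' u hu u' hu' heq
  simp only [Finset.mem_image] at hs hs' ht ht' hu hu'
  obtain ⟨s₀, hs₀, rfl⟩ := hs
  obtain ⟨s₀', hs₀', rfl⟩ := hs'
  obtain ⟨t₀, ht₀, rfl⟩ := ht
  obtain ⟨t₀', ht₀', rfl⟩ := ht'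
  obtain ⟨u₀, hu₀, rfl⟩ := hu
  obtain ⟨u₀', hu₀', rfl⟩ := hu'
  have key : s₀ * a * (s₀' * a)⁻¹ * (t₀ * b * (t₀' * b)⁻¹) * (u₀ * c * (u₀' * c)⁻¹)
      = s₀ * s₀'⁻¹ * (t₀ * t₀'⁻¹) * (u₀ * u₀'⁻¹) := by group
  rw [key] at heq
  obtain ⟨h1, h2, h3⟩ := h s₀ hs₀ s₀' hs₀' t₀ ht₀ t₀' ht₀' u₀ hu₀ u₀' hu₀' heq
  exact ⟨by rw [h1], by rw [h2], by rw [h3]⟩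

/-- **Card `cyclotomic-triality`, first lemma.** For `τ³ = 1`, the Z₃-symmetric triple
`(X, τXτ⁻¹, τ²Xτ⁻²)` has the TPP iff the quotient set `Q(X)` has no nontrivial solution of the
twisted corner equation `q₁ τ q₂ τ q₃ τ = 1`. -/
theorem tpp_triality_iff (τ : G) (hτ : τ ^ 3 = 1) (X : Finset G) :
    TripleProductProperty X (conjSet τ X) (conjSet (τ ^ 2) X) ↔
      ∀ x₁ ∈ X, ∀ x₁' ∈ X, ∀ x₂ ∈ X, ∀ x₂' ∈ X, ∀ x₃ ∈ X, ∀ x₃' ∈ X,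
        x₁ * x₁'⁻¹ * τ * (x₂ * x₂'⁻¹) * τ * (x₃ * x₃'⁻¹) * τ = 1 →
          x₁ = x₁' ∧ x₂ = x₂' ∧ x₃ = x₃' := by
  have hτ3 : τ * τ * τ = 1 := by rw [← pow_three']; exact hτ
  have htt : τ * τ = τ⁻¹ := by rw [eq_inv_iff_mul_eq_one]; exact hτ3
  have h2 : τ ^ 2 = τ⁻¹ := by rw [pow_two, htt]
  have hinv2 : τ⁻¹ * τ⁻¹ = τ := by rw [← mul_inv_rev, htt, inv_inv]
  -- the product for conjugated elements equals the twisted product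
  have twist : ∀ x₁ x₁' x₂ x₂' x₃ x₃' : G,
      x₁ * x₁'⁻¹ * (τ * x₂ * τ⁻¹ * (τ * x₂' * τ⁻¹)⁻¹) * (τ ^ 2 * x₃ * (τ ^ 2)⁻¹ * (τ ^ 2 * x₃' * (τ ^ 2)⁻¹)⁻¹)
        = x₁ * x₁'⁻¹ * τ * (x₂ * x₂'⁻¹) * τ * (x₃ * x₃'⁻¹) * τ := by
    intro x₁ x₁' x₂ x₂' x₃ x₃'
    rw [h2]
    calc x₁ * x₁'⁻¹ * (τ * x₂ * τ⁻¹ * (τ * x₂' * τ⁻¹)⁻¹) * (τ⁻¹ * x₃ * τ⁻¹⁻¹ * (τ⁻¹ * x₃' * τ⁻¹⁻¹)⁻¹)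
        = x₁ * x₁'⁻¹ * τ * (x₂ * x₂'⁻¹) * (τ⁻¹ * τ⁻¹) * (x₃ * x₃'⁻¹) * τ := by group
      _ = x₁ * x₁'⁻¹ * τ * (x₂ * x₂'⁻¹) * τ * (x₃ * x₃'⁻¹) * τ := by rw [hinv2]
  constructor
  · intro h x₁ h₁ x₁' h₁' x₂ h₂ x₂' h₂' x₃ h₃ x₃' h₃' heq
    have hm : ∀ {σ : G} {x : G}, x ∈ X → σ * x * σ⁻¹ ∈ conjSet σ X := fun {σ x} hx =>
      mem_conjSet.2 ⟨x, hx, rfl⟩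
    have := h x₁ h₁ x₁' h₁' _ (hm h₂) _ (hm h₂') _ (hm h₃) _ (hm h₃') (by rw [twist]; exact heq)
    obtain ⟨e1, e2, e3⟩ := this
    exact ⟨e1, conj_injective τ e2, conj_injective (τ ^ 2) e3⟩
  · intro h s hs s' hs' t ht t' ht' u hu u' hu' heq
    obtain ⟨x₂, h₂, rfl⟩ := mem_conjSet.1 ht
    obtain ⟨x₂', h₂', rfl⟩ := mem_conjSet.1 ht'
    obtain ⟨x₃, h₃, rfl⟩ := mem_conjSet.1 hu
    obtain ⟨x₃', h₃', rfl⟩ := mem_conjSet.1 hu'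
    rw [twist] at heq
    obtain ⟨e1, e2, e3⟩ := h s hs s' hs' x₂ h₂ x₂' h₂' x₃ h₃ x₃' h₃' heq
    exact ⟨e1, by rw [e2], by rw [e3]⟩

/-- **Transfer C⁺ of card `cyclotomic-triality`.** Threshold TPP triples of the Z₃-symmetric form
`(X, X^τ, X^{τ²})` in `S_n`. -/
def TrialityThreshold : Prop :=
  ∀ c : ℝ, 0 < c → ∀ n₀ : ℕ, ∃ n ≥ n₀, ∃ τ : Equiv.Perm (Fin n), τ ^ 3 = 1 ∧
    ∃ X : Finset (Equiv.Perm (Fin n)),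
      TripleProductProperty X (conjSet τ X) (conjSet (τ ^ 2) X) ∧
      (n.factorial : ℝ) ^ ((3 : ℝ) / 2) * Real.exp (-(c * Real.sqrt (n : ℝ))) <
        ((X.card * X.card * X.card : ℕ) : ℝ)

/-- `TrialityThreshold` implies the crux (forget the symmetry). -/
theorem thresholdSubsetTriples_of_triality (h : TrialityThreshold) :
    SnSubsetDichotomy.ThresholdSubsetTriples := by
  intro c hc n₀
  obtain ⟨n, hn, τ, _hτ, X, hTPP, hbig⟩ := h c hc n₀
  refine ⟨n, hn, X, conjSet τ X, conjSet (τ ^ 2) X, hTPP, ?_⟩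
  rw [card_conjSet, card_conjSet]
  exact hbig

/-- **Card `pairing-principle-reduction`, structure conjecture (negative-side companion, a CONJECTURE).**
Every near-threshold TPP triple of subsets of `S_n` is commensurable with right cosets of centralisers of
(near-)perfect matchings: each set meets some coset `C(μ)h⁻¹` in at least an `e^{-c√n}·n^{-C}` fraction.
(Heuristic basis: entropy-neutral structure at scale `√(n!)` is either `√(en)`-windows, which collide
(the √e wall), or a globally coherent pairing; incoherent pairings and coset unions lose `e^{-Θ(n)}`.) -/
def PairingStructure : Prop :=
  ∃ C : ℝ, ∀ c : ℝ, 0 < c → ∃ n₀ : ℕ, ∀ n ≥ n₀, ∀ S T U : Finset (Equiv.Perm (Fin n)),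
    TripleProductProperty S T U →
    (n.factorial : ℝ) ^ ((3 : ℝ) / 2) * Real.exp (-(c * Real.sqrt (n : ℝ))) <
        ((S.card * T.card * U.card : ℕ) : ℝ) →
    ∀ X : Finset (Equiv.Perm (Fin n)), (X = S ∨ X = T ∨ X = U) →
      ∃ μ : Equiv.Perm (Fin n), μ * μ = 1 ∧ (∀ x y, μ x = x → μ y = y → x = y) ∧
        ∃ h : Equiv.Perm (Fin n),
          Real.exp (-(c * Real.sqrt (n : ℝ))) * (n : ℝ) ^ (-C) * (X.card : ℝ) ≤
            ((X.filter (fun x => x * h * μ = μ * (x * h))).card : ℝ)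

/-- The reduction the card asks the negative side to prove (statement only; bookkeeping through
`tpp_mul_right`, `TripleProductProperty.mono` and a dense-subset form of `HyperoctahedralSubsets`). -/
def PairingReduction : Prop :=
  PairingStructure → SnSubsetDichotomy.HyperoctahedralSubsets → SnSubsetDichotomy.NoThresholdSubsetTriple

end Summit.MatrixMultiplication.MatrixMultiplication.Cruxes.ThresholdSubsetTriples.Ideator2
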